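import Summits.BirchSwinnertonDyer.BirchSwinnertonDyer.Theorems.GenusKolyvaginAtTwoGenusPrimitiveSupplyAtTwoTwoTranspositionIff
import Literature.NumberTheory.EllipticCurves.SubgroupSelmerCocycleCriteriaProofs
import HarnessLib

/-!
# Route `GenusKolyvaginAtTwo`, crux #2 `GenusPrimitiveSupplyAtTwo` (stmt-BirchSwinnertonDyer-22136):
# HALF OF THE ONE-PLACE DICTIONARY — a class vanishing at `v` satisfies the twisted `PrimeTwist` condition above `v` — and with it the
# direction «`R ∩` twisted conditions `= ⊥ ⟹ #Sel₂(W^{(d)}) = 1`» of T-2q (a) BY NAME-SHAPE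

Width seat `bsd-line-gk2-p4` g14 (cell `bsd-f1-sign2`), sequel of `…TwoTranspositionIff`. THEOREMS ONLY; helper `--supports stmt-BirchSwinnertonDyer-22136`;
no item is closed; BSD is not proved by any of this.

WHAT.
* `mem_primeTwist_selmerLocalKer_of_res_eq_zero` — for ANY `W/K`, prime `p`, character `χ : Γ_K → ℤ/p`, `K`-field `E`: a class of `H¹(K, E[p])`
  that DIES in `H¹(Γ_E, E[p])` dies a fortiori in `H¹(Γ_E, A_χ(K̄_E))`, i.e. lies in Mazur–Rubin's twisted local condition `PrimeTwist.selmerLocalKer W χ E`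
  (the compatible pair `(res, E[p] → A_χ)` factors through `(res, id)`; on cocycles: a principal cocycle stays principal after changing coefficients).
* `ker_localization_le_twistCondAbove` — hence `ker loc_{v_q} ≤ twistCondAbove W χ q` at the place `v_q` of a prime `q`.
* **`twistSelmerTwoCard_eq_one_of_twistCond_inf_eq_bot`** — T-2q (a), direction `←` of its `iff`, VERBATIM SHAPE and unconditional: under T-2q's
  binders and a door open at `q₀` or `q₁`, `selmerGroupRelaxedAtInfinityAtTwo W ⊓ twistCondAbove W χ q₀ ⊓ twistCondAbove W χ q₁ = ⊥ ⟹ #Sel₂(W^{(d)}) = 1`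
  (for EVERY character `χ`: the twisted conditions contain the kernels, so the strict intersection of `…TwoTranspositionIff` is `⊥` too).
The converse direction needs the other half of the dictionary («`c ∈ twistCondAbove W χ q ∧ loc_q c ∈ 𝓚_q ⟹ loc_q c = 0`», transversality of
`A_χ`'s Kummer line with `W`'s), see `…TwoTranspositionOfDictionary`.

References: [MazurRubin2007] §2, Def. 4.3; [MazurRubin2010] §3; [SerreGaloisCohomology1997] I §2.4.
-/

set_option linter.dupNamespace false -- tree convention: `Summit.BirchSwinnertonDyer.BirchSwinnertonDyer.Theorems` (summit = sub-problem)
set_option autoImplicit false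

noncomputable section

open scoped Classical ContRepresentation

namespace Summit.BirchSwinnertonDyer.BirchSwinnertonDyer.Theorems.GenusKolyTransp

open WeierstrassCurve Field NumberField IsDedekindDomain Function
open Literature.NumberTheory.EllipticCurves Literature.NumberTheory.GaloisRepresentations
open Literature.NumberTheory.GaloisCohomology
open Literature.NumberTheory.EllipticCurves.CocycleCriteria (resH1Hom_oneCocycleClass_eq_zero_iff)
open Rat.HeightOneSpectrum (primesEquiv natGenerator)
open Summit.BirchSwinnertonDyer.Rank1Residual.F1Sign2
open Summit.BirchSwinnertonDyer.Rank1Residual.F1Sign2.TranspositionDoor (MeetsNonNormAt)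
open Summit.BirchSwinnertonDyer.Rank1Residual.F1Sign2.TwoDoor (TwoTranspAdmissible twistCondAbove)
open Summit.BirchSwinnertonDyer.Rank1Residual.X11b.KummerPT (kummerRelaxed)
open Summit.BirchSwinnertonDyer.BirchSwinnertonDyer.Theorems.GenusKolyTwistingPrime (primesEquiv_eq)

universe u

/-! ## §29 A class dying in `H¹(Γ_E, E[p])` dies in `H¹(Γ_E, A_χ)` -/

/-- **A class of `H¹(K, E[p])` vanishing in `H¹(Γ_E, E[p])` lies in the twisted local condition `PrimeTwist.selmerLocalKer W χ E`**
(`= ker (H¹(K, E[p]) → H¹(Γ_E, A_χ(K̄_E)))`): the restricted cocycle is principal, `z(σ) = σm − m` on `Γ_E`, hence so is its image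
`ψ(z(σ)) = σ·ψ(m) − ψ(m)` under the equivariant `ψ : E[p] → A_χ(K̄_E)`. [cite: SerreGaloisCohomology1997, I §2.4 (compatible pairs)]
[cite: MazurRubin2007, Def 4.3] -/
theorem mem_primeTwist_selmerLocalKer_of_res_eq_zero {K : Type u} [Field K] (W : WeierstrassCurve K) {p : ℕ} [Fact p.Prime]
    (χ : Field.absoluteGaloisGroup K →ₜ* Multiplicative (ZMod p)) (E : Type u) [Field E] [Algebra K E]
    (c : W.galH1Torsion (p : ℤ)) (hc : galoisCohomology.res (W.torsionGaloisModule (p : ℤ)) E 1 c = 0) :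
    c ∈ PrimeTwist.selmerLocalKer W χ E := by
  obtain ⟨z, rfl⟩ := oneCocycleClass_surjective (discreteTopRep (absoluteGaloisGroup K) (geomTorsion W (p : ℤ))) c
  rw [res_torsionGaloisModule_oneCocycleClass] at hc
  obtain ⟨m, hm⟩ := (oneCocycleClass_eq_zero_iff _ _).mp hc
  rw [PrimeTwist.selmerLocalKer, resKer_eq_ker, AddMonoidHom.mem_ker]
  refine (resH1Hom_oneCocycleClass_eq_zero_iff _ _ _ z).mpr
    ⟨((PrimeTwist.locMap W χ E).comp (PrimeTwist.constEmb _ W.geomPoints)) m, fun x ↦ ?_⟩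
  have hx := hm x
  rw [contOneCocycles.pullback_apply] at hx
  -- `z (res x) = (res x) • m − m` in `E[p]`
  have hx' : z.1 (resGal (K := K) E x) = resGal (K := K) E x • m - m := hx
  rw [hx', map_sub, AddMonoidHom.comp_apply, AddMonoidHom.comp_apply, PrimeTwist.constEmb_smul, PrimeTwist.locMap_smul]

/-! ## §30 `ker loc_{v_q} ≤ twistCondAbove W χ q` -/

/-- **A class vanishing at the place `v` of `q` lies in `twistCondAbove W χ q`** (the twisted conditions above `q` are an intersection over the
places `v' ∋ q`, all equal to `v`). [cite: MazurRubin2007, Def 4.3] -/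
theorem ker_localization_le_twistCondAbove (W : WeierstrassCurve ℚ) (χ : Field.absoluteGaloisGroup ℚ →ₜ* Multiplicative (ZMod 2))
    {q : ℕ} (hq : q.Prime) {v : HeightOneSpectrum (𝓞 ℚ)} (hv : (q : 𝓞 ℚ) ∈ v.asIdeal) :
    (galoisCohomology.localization (W.torsionGaloisModule ((2 : ℕ) : ℤ)) (Sum.inr v) 1).ker ≤ twistCondAbove W χ q := by
  intro c hc
  have hc' : galoisCohomology.localization (W.torsionGaloisModule ((2 : ℕ) : ℤ)) (Sum.inr v) 1 c = 0 := hc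
  haveI : Fact (Nat.Prime 2) := ⟨Nat.prime_two⟩
  have key : ∀ v' : HeightOneSpectrum (𝓞 ℚ), (q : 𝓞 ℚ) ∈ v'.asIdeal →
      c ∈ PrimeTwist.selmerLocalKer W χ (v'.adicCompletion ℚ) := by
    intro v' hv'
    have hvv : v' = v :=
      primesEquiv.injective (Subtype.ext ((primesEquiv_eq hq hv').trans (primesEquiv_eq hq hv).symm))
    subst hvv
    exact mem_primeTwist_selmerLocalKer_of_res_eq_zero W χ (v'.adicCompletion ℚ) c hc'
  show c ∈ twistCondAbove W χ q
  exact AddSubgroup.mem_iInf.mpr fun v' ↦ AddSubgroup.mem_iInf.mpr fun hv' ↦ key v' hv'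

/-! ## §31 T-2q (a), direction `←` of the `iff`, verbatim shape -/

/-- **T-2q (a), `←`: «no non-zero class of the ∞-relaxed group satisfies the twisted conditions above `q₀` and `q₁`» ⟹ `#Sel₂(W^{(d)}) = 1`**,
for every globally minimal `W` with `Δ > 0`, `E(ℚ)[2] = 0`, rank `1`, `Ш[2] = 0`, `E(ℚ) ⊂ E⁰(ℝ)`, every two-transposition-admissible `(d, q₀, q₁)`
with a door open, and EVERY character `χ`: the twisted conditions contain `ker loc_{v_i}`, so the strict intersection of `twoTranspositionTwistLaw_iff_strict`
is `⊥` as well. [cite: MazurRubin2010, Lemma 3.2 and Prop 3.3] [cite: PoonenRains2012, Thm. 4.14] -/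
theorem twistSelmerTwoCard_eq_one_of_twistCond_inf_eq_bot (W : WeierstrassCurve ℚ) [W.IsElliptic] [W.IsGloballyMinimal]
    (hΔ : 0 < W.Δ) (hT : NoRationalTwoTorsion W) (hrank : W.mordellWeilRank = 1) (hSha : ShaTwoTrivial W) (hegg : ¬ MeetsEgg W)
    (d : ℤ) (q₀ q₁ : ℕ) [Fact q₀.Prime] [Fact q₁.Prime] (χ : Field.absoluteGaloisGroup ℚ →ₜ* Multiplicative (ZMod 2))
    (hadm : TwoTranspAdmissible W d q₀ q₁) (hdoor : MeetsNonNormAt W q₀ ∨ MeetsNonNormAt W q₁)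
    (hbot : selmerGroupRelaxedAtInfinityAtTwo W ⊓ twistCondAbove W χ q₀ ⊓ twistCondAbove W χ q₁ = ⊥) :
    twistSelmerTwoCard W d = 1 := by
  have hq₀ : q₀.Prime := Fact.out
  have hq₁ : q₁.Prime := Fact.out
  have hplace : ∀ {q : ℕ} (hq : q.Prime), ∃ v : HeightOneSpectrum (𝓞 ℚ), (q : 𝓞 ℚ) ∈ v.asIdeal := fun {q} hq ↦
    ⟨primesEquiv.symm ⟨q, hq⟩, by
      have h := Rat.HeightOneSpectrum.natCast_natGenerator_mem (primesEquiv.symm ⟨q, hq⟩)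
      rwa [show natGenerator (primesEquiv.symm ⟨q, hq⟩) = q from
        congrArg Subtype.val (primesEquiv.apply_symm_apply (⟨q, hq⟩ : Nat.Primes))] at h⟩
  obtain ⟨v₀, hv₀⟩ := hplace hq₀
  obtain ⟨v₁, hv₁⟩ := hplace hq₁
  refine (twoTranspositionTwistLaw_iff_strict_relaxedAtInfinity W hΔ hT hrank hSha hegg d q₀ q₁ hadm v₀ v₁ hv₀ hv₁ hdoor).mpr ?_
  rw [eq_bot_iff] at hbot ⊢
  refine le_trans ?_ hbot
  exact inf_le_inf (inf_le_inf le_rfl (ker_localization_le_twistCondAbove W χ hq₀ hv₀)) (ker_localization_le_twistCondAbove W χ hq₁ hv₁)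

end Summit.BirchSwinnertonDyer.BirchSwinnertonDyer.Theorems.GenusKolyTransp

end
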